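import Summits.BirchSwinnertonDyer.Rank1Residual.Additive.ThreeAdicLift
import Mathlib.RingTheory.DedekindDomain.AdicValuation
import Mathlib.AlgebraicGeometry.EllipticCurve.Weierstrass
import HarnessLib

/-!
# Two bracket lemmas on Tate's Kodaira-III / III* shapes of `(b₂, b₄, b₆, Δ)` over a completion `K_v`
# with `3` a uniformiser: the `4Δ`-bracket `4δ = −32β₄³ + 3β₂²β₄² + 9(…)` with `β₄ ∈ 𝒪_v^×`, and the
# `c₆`-bracket `β₂ ∈ 3𝒪_v ⟹ v(c₆) ≥ m + 2` (local kernel of `Additive/LocIrrThreeIffCubeTame.lean`)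
# (cell `b2b-bsdres`; seat `b2b-bsdres-x11b3-p7` GEN 8 as CROSS-CELL POOL HAND — harvest-2 GEN 37 E83
#  §4 (c) / `Additive/UnitPartModNineTameFour.lean` "the bridge … is the prover's pen"; theorems only)

HONEST FRAMING (cell `b2b-bsdres`, run/shared/lean/b2b/bsd-rank1-residual/, verbatim in every file): the
goal of the cell is to DELETE the COMBINATION-SHAPED residual classes of the Birch–Swinnerton-Dyer formula
for ALL analytic-rank `≤ 1` elliptic curves over `ℚ` — "full BSD formula for every rank `≤ 1` curve in
class `C`" assembled STRICTLY from published theorems — so that the rank-`≤ 1` remainder becomes exactly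
the CONSTRUCTION-SHAPED classes, which are TYPED (missing-input `Prop`s), NOT attempted. This is not
"finishing BSD". Lane CLASS-CLOSURE / teams o5–o6 (O5 OPEN): research routes; census output is
EVIDENCE, never a Literature fact; nothing is booked; no mark of `RESIDUAL-MAP.md` moves. This file:
THEOREMS ONLY (no definition, no named fact, no `@[conjecture]` node, no `sorry`; net named-fact debt
`0`). It proves NOTHING about any elliptic curve over `ℚ`: local algebra on a Weierstrass equation
over the completion `K_v` of a Dedekind fraction field at a place `v` with uniformiser `π`, `π = 3` in
`K_v` (residue characteristic `3`).

## What is proved (valuation convention: Mathlib's multiplicative one on `K_v`, `w = Valued.v`,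
## `w π = exp (−1)`)

On a `K_v`-model `N` with `b₂ = π^{k₂}β₂`, `b₄ = π^{k₄}β₄`, `b₆ = π^{k₆}β₆` (`βᵢ ∈ 𝒪_v`) in the two tame
potentially-supersingular shapes of Tate's algorithm at residue characteristic `3` — type III:
`(k₂, k₄, k₆) = (1, 1, 2)`, `Δ = π³δ`, `c₆ = π³·I`; type III*: `(2, 3, 5)`, `Δ = π⁹δ`, `c₆ = π⁶·I`
(Silverman *ATAEC* IV.9.4 Steps 4, 9; the tree's `exists_variableChange_b_of_kodairaSymbolAt_eq_III` /
`_eq_IIIstar`, bsd.S15):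
* `valued_δ_bracket_of_tame_shape` — with `δ ∈ 𝒪_v^×`: **`β₄` is a unit** and
  **`4δ = −32β₄³ + 3β₂²β₄² + 9·(−β₂³β₆ − 36β₆² + 12β₂β₄β₆)`** — Mathlib's `b_relation`
  `4b₈ = b₂b₆ − b₄²` inserted into `Δ = −b₂²b₈ − 8b₄³ − 27b₆² + 9b₂b₄b₆` and the powers of `π = 3`
  cancelled (`27` resp. `3⁹`: the weight scaling makes III and III* give the SAME bracket); `β₄` is a unit
  because otherwise every term on the right lies in `3𝒪_v` while `w (4δ) = 1`. Read in `𝒪_v/9 = ℤ/9` this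
  is harvest-2's `Δ̃ ≡ −b′³ + 3a′²b′² (mod 9)` (`Additive/UnitPartModNineTameFour.lean`, in Freitas–Kraus
  coordinates) now on Tate's normal form: `δ ≡ β₄³ + 3β₂²β₄² (mod 9)`.
* `valued_c₆_le_of_tame_shape_of_b₂` — `c₆ = −b₂³ + 36b₂b₄ − 216b₆ = 3^m·(−β₂³ + 3·4β₂β₄ − 9·8β₆)`
  (`m = 3` / `6`), and if `β₂ ∈ 3𝒪_v` (`w β₂ ≤ exp (−1)`) the bracket lies in `9𝒪_v`:
  **`w c₆ ≤ exp (−(m + 2))`** — the non-unit half of the bracket lemma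
  `valued_j_sub_eq_or_le_of_b_shape` of `Additive/SelectorIdentityTameThreeHolds.lean` (x11b3-p7 GEN 7),
  exported on its own because the converse of L-O6-irr needs exactly this direction.

References: J. H. Silverman, *Advanced Topics in the Arithmetic of Elliptic Curves*, GTM 151 (1994),
IV.9.4 Steps 4, 9, Table 4.1 [SilvermanATAEC1994]; N. Freitas, A. Kraus, Mem. AMS 277 (2022) no. 1361,
§19 Lemma 19 (i) [FreitasKraus2022].
-/

noncomputable section

open WeierstrassCurve IsDedekindDomain IsDedekindDomain.HeightOneSpectrum WithZero

namespace Summit.BirchSwinnertonDyer.Rank1Residual.Additive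


/-! ## §1 Local algebra on a `K_v`-model with the III / III* shapes (`3` a uniformiser) -/

section Local

variable {A : Type*} [CommRing A] [IsDedekindDomain A] {K : Type*} [Field K] [Algebra A K]
  [IsFractionRing A K] (v : HeightOneSpectrum A)

/-- **The `4Δ` bracket on the tame shapes.** On a `K_v`-model with `b₂ = π^{k₂}β₂`, `b₄ = π^{k₄}β₄`,
`b₆ = π^{k₆}β₆`, `Δ = π^e δ` (`βᵢ ∈ 𝒪_v`, `δ ∈ 𝒪_v^×`), `(k₂,k₄,k₆;e) = (1,1,2;3)` [III] or
`(2,3,5;9)` [III*], and `π = 3` in `K_v`: `β₄` is a unit and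
`4δ = −32β₄³ + 3β₂²β₄² + 9(−β₂³β₆ − 36β₆² + 12β₂β₄β₆)` (from `4Δ = −b₂²(b₂b₆ − b₄²) − 32b₄³ − 108b₆²
+ 36b₂b₄b₆`, i.e. Mathlib's `b_relation` inserted in `Δ`; the weight scaling makes III and III* give the
same bracket). [cite: SilvermanATAEC1994, IV.9.4 Steps 4 and 9 (normal forms of III, III*)] -/
theorem valued_δ_bracket_of_tame_shape {π : K} (hπ : v.valuation K π = exp (-1 : ℤ))
    (h3 : (π : v.adicCompletion K) = 3) (N : WeierstrassCurve (v.adicCompletion K))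
    {k₂ k₄ k₆ e : ℕ} (β₂ β₄ β₆ δ : v.adicCompletionIntegers K) (hδ : IsUnit δ)
    (hb₂ : N.b₂ = (π : v.adicCompletion K) ^ k₂ * β₂)
    (hb₄ : N.b₄ = (π : v.adicCompletion K) ^ k₄ * β₄)
    (hb₆ : N.b₆ = (π : v.adicCompletion K) ^ k₆ * β₆)
    (hΔ : N.Δ = (π : v.adicCompletion K) ^ e * δ)
    (hk : (k₂ = 1 ∧ k₄ = 1 ∧ k₆ = 2 ∧ e = 3) ∨ (k₂ = 2 ∧ k₄ = 3 ∧ k₆ = 5 ∧ e = 9)) :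
    Valued.v (β₄ : v.adicCompletion K) = 1 ∧
      4 * (δ : v.adicCompletion K) = -32 * (β₄ : v.adicCompletion K) ^ 3 +
        3 * (β₂ : v.adicCompletion K) ^ 2 * (β₄ : v.adicCompletion K) ^ 2 +
        9 * (-(β₂ : v.adicCompletion K) ^ 3 * β₆ - 36 * (β₆ : v.adicCompletion K) ^ 2 +
          12 * β₂ * β₄ * β₆) := by
  set w : Valuation (v.adicCompletion K) ℤᵐ⁰ := Valued.v with hw
  have hπv : w (π : v.adicCompletion K) = exp (-1 : ℤ) := by
    rw [hw, valuedAdicCompletion_eq_valuation', hπ]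
  rw [h3] at hπv hb₂ hb₄ hb₆ hΔ
  have h30 : (3 : v.adicCompletion K) ≠ 0 := fun h ↦ by
    rw [h, map_zero] at hπv; exact exp_ne_zero hπv.symm
  have hint : ∀ β : v.adicCompletionIntegers K, w (β : v.adicCompletion K) ≤ 1 := fun β ↦ β.2
  have hnat : ∀ n : ℕ, w (n : v.adicCompletion K) ≤ 1 := fun n ↦ by
    rw [← map_natCast (algebraMap K (v.adicCompletion K)) n]
    have : w (algebraMap K (v.adicCompletion K) n) = v.valuation K n :=
      valuedAdicCompletion_eq_valuation' v (n : K)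
    rw [this, ← map_natCast (algebraMap A K) n]
    exact v.valuation_le_one _
  have hwδ : w (δ : v.adicCompletion K) = 1 := by
    obtain ⟨γ, hγ⟩ := hδ.exists_right_inv
    have h1 : w (δ : v.adicCompletion K) * w (γ : v.adicCompletion K) = 1 := by
      rw [← map_mul, ← Subring.coe_mul, hγ]; simp
    refine le_antisymm (hint δ) ?_
    calc (1 : ℤᵐ⁰) = _ := h1.symm
      _ ≤ w (δ : v.adicCompletion K) * 1 := mul_le_mul' le_rfl (hint γ)
      _ = _ := mul_one _
  -- the identity
  have h4Δ : 4 * N.Δ = -N.b₂ ^ 2 * (N.b₂ * N.b₆ - N.b₄ ^ 2) - 32 * N.b₄ ^ 3 - 108 * N.b₆ ^ 2 +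
      36 * N.b₂ * N.b₄ * N.b₆ := by
    rw [← N.b_relation]; simp only [WeierstrassCurve.Δ]; ring
  have hid : 4 * (δ : v.adicCompletion K) = -32 * (β₄ : v.adicCompletion K) ^ 3 +
      3 * (β₂ : v.adicCompletion K) ^ 2 * (β₄ : v.adicCompletion K) ^ 2 +
      9 * (-(β₂ : v.adicCompletion K) ^ 3 * β₆ - 36 * (β₆ : v.adicCompletion K) ^ 2 +
        12 * β₂ * β₄ * β₆) := by
    rw [hb₂, hb₄, hb₆, hΔ] at h4Δ
    rcases hk with ⟨rfl, rfl, rfl, rfl⟩ | ⟨rfl, rfl, rfl, rfl⟩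
    · have h27 : (3 : v.adicCompletion K) ^ 3 ≠ 0 := pow_ne_zero _ h30
      refine mul_left_cancel₀ h27 ?_
      linear_combination h4Δ
    · have h39 : (3 : v.adicCompletion K) ^ 9 ≠ 0 := pow_ne_zero _ h30
      refine mul_left_cancel₀ h39 ?_
      linear_combination h4Δ
  refine ⟨?_, hid⟩
  -- `β₄` is a unit: otherwise every term on the right is in `3𝒪`, but `w (4δ) = 1`
  by_contra hne
  have hlt : w (β₄ : v.adicCompletion K) < 1 := lt_of_le_of_ne (hint β₄) hne
  have hβ₄' : w (β₄ : v.adicCompletion K) ≤ exp (-1 : ℤ) := by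
    have := ThreeAdicLift.le_exp_sub_one_of_lt_exp (n := 0) (by rwa [exp_zero])
    rwa [show (0 : ℤ) - 1 = -1 by norm_num] at this
  have w3 : w 3 = exp (-1 : ℤ) := hπv
  have w4 : w 4 = 1 := by
    rw [show (4 : v.adicCompletion K) = 1 + 3 by norm_num]
    exact Valuation.map_one_add_of_lt w (by rw [w3, ← exp_zero, exp_lt_exp]; norm_num)
  have hlhs : w (4 * (δ : v.adicCompletion K)) = 1 := by rw [map_mul, w4, hwδ, one_mul]
  have hT1 : w (-32 * (β₄ : v.adicCompletion K) ^ 3) < 1 := by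
    rw [map_mul, Valuation.map_neg, map_pow]
    calc w 32 * w (β₄ : v.adicCompletion K) ^ 3 ≤ 1 * exp (-1 : ℤ) ^ 3 :=
          mul_le_mul' (by exact_mod_cast hnat 32) (pow_le_pow_left' hβ₄' 3)
      _ < 1 := by rw [one_mul, ← exp_nsmul, ← exp_zero, exp_lt_exp]; norm_num
  have hT2 : w (3 * (β₂ : v.adicCompletion K) ^ 2 * (β₄ : v.adicCompletion K) ^ 2) < 1 := by
    rw [map_mul, map_mul, map_pow, map_pow, w3]
    calc exp (-1 : ℤ) * w (β₂ : v.adicCompletion K) ^ 2 * w (β₄ : v.adicCompletion K) ^ 2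
        ≤ exp (-1 : ℤ) * 1 ^ 2 * 1 ^ 2 :=
          mul_le_mul' (mul_le_mul' le_rfl (pow_le_pow_left' (hint β₂) 2))
            (pow_le_pow_left' (hint β₄) 2)
      _ < 1 := by rw [one_pow, mul_one, mul_one, ← exp_zero, exp_lt_exp]; norm_num
  have hT3 : w (9 * (-(β₂ : v.adicCompletion K) ^ 3 * β₆ - 36 * (β₆ : v.adicCompletion K) ^ 2 +
      12 * β₂ * β₄ * β₆)) < 1 := by
    rw [map_mul, show (9 : v.adicCompletion K) = 3 * 3 by norm_num, map_mul, w3, ← exp_add]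
    have hin : w (-(β₂ : v.adicCompletion K) ^ 3 * β₆ - 36 * (β₆ : v.adicCompletion K) ^ 2 +
        12 * β₂ * β₄ * β₆) ≤ 1 := by
      refine Valuation.map_add_le w (Valuation.map_sub_le w ?_ ?_) ?_
      · rw [map_mul, Valuation.map_neg, map_pow]
        calc w (β₂ : v.adicCompletion K) ^ 3 * w (β₆ : v.adicCompletion K) ≤ 1 ^ 3 * 1 :=
              mul_le_mul' (pow_le_pow_left' (hint β₂) 3) (hint β₆)
          _ = 1 := by rw [one_pow, one_mul]
      · rw [map_mul, map_pow]
        calc w 36 * w (β₆ : v.adicCompletion K) ^ 2 ≤ 1 * 1 ^ 2 :=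
              mul_le_mul' (by exact_mod_cast hnat 36) (pow_le_pow_left' (hint β₆) 2)
          _ = 1 := by rw [one_pow, one_mul]
      · rw [map_mul, map_mul, map_mul]
        calc w 12 * w (β₂ : v.adicCompletion K) * w (β₄ : v.adicCompletion K) *
            w (β₆ : v.adicCompletion K) ≤ 1 * 1 * 1 * 1 :=
              mul_le_mul' (mul_le_mul' (mul_le_mul' (by exact_mod_cast hnat 12) (hint β₂))
                (hint β₄)) (hint β₆)
          _ = 1 := by rw [one_mul, one_mul, one_mul]
    calc exp (-1 + -1 : ℤ) * w _ ≤ exp (-1 + -1 : ℤ) * 1 := mul_le_mul' le_rfl hin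
      _ < 1 := by rw [mul_one, ← exp_zero, exp_lt_exp]; norm_num
  have hrhs := Valuation.map_add_lt w (Valuation.map_add_lt w hT1 hT2) hT3
  rw [← hid, hlhs] at hrhs
  exact lt_irrefl _ hrhs

/-- **The `c₆` bracket on the tame shapes when `β₂ ∈ 3𝒪`.** With the shapes above
(`(k₂,k₄,k₆;m) = (1,1,2;3)` or `(2,3,5;6)`): `c₆ = −b₂³ + 36b₂b₄ − 216b₆ = 3^m·(−β₂³ + 3·4β₂β₄ − 9·8β₆)`,
and if `w β₂ ≤ exp (−1)` every term of the bracket lies in `9𝒪`, so `w c₆ ≤ exp (−(m + 2))`.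
[cite: SilvermanATAEC1994, IV.9.4 Steps 4 and 9] -/
theorem valued_c₆_le_of_tame_shape_of_b₂ {π : K} (hπ : v.valuation K π = exp (-1 : ℤ))
    (h3 : (π : v.adicCompletion K) = 3) (N : WeierstrassCurve (v.adicCompletion K))
    {k₂ k₄ k₆ m : ℕ} (β₂ β₄ β₆ : v.adicCompletionIntegers K)
    (hb₂ : N.b₂ = (π : v.adicCompletion K) ^ k₂ * β₂)
    (hb₄ : N.b₄ = (π : v.adicCompletion K) ^ k₄ * β₄)
    (hb₆ : N.b₆ = (π : v.adicCompletion K) ^ k₆ * β₆)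
    (hk : (k₂ = 1 ∧ k₄ = 1 ∧ k₆ = 2 ∧ m = 3) ∨ (k₂ = 2 ∧ k₄ = 3 ∧ k₆ = 5 ∧ m = 6))
    (hβ₂ : Valued.v (β₂ : v.adicCompletion K) ≤ exp (-1 : ℤ)) :
    Valued.v N.c₆ ≤ exp (-((m : ℤ) + 2)) := by
  set w : Valuation (v.adicCompletion K) ℤᵐ⁰ := Valued.v with hw
  have hπv : w (π : v.adicCompletion K) = exp (-1 : ℤ) := by
    rw [hw, valuedAdicCompletion_eq_valuation', hπ]
  rw [h3] at hπv hb₂ hb₄ hb₆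
  have hint : ∀ β : v.adicCompletionIntegers K, w (β : v.adicCompletion K) ≤ 1 := fun β ↦ β.2
  have hnat : ∀ n : ℕ, w (n : v.adicCompletion K) ≤ 1 := fun n ↦ by
    rw [← map_natCast (algebraMap K (v.adicCompletion K)) n]
    have : w (algebraMap K (v.adicCompletion K) n) = v.valuation K n :=
      valuedAdicCompletion_eq_valuation' v (n : K)
    rw [this, ← map_natCast (algebraMap A K) n]
    exact v.valuation_le_one _
  have w3 : w 3 = exp (-1 : ℤ) := hπv
  set I : v.adicCompletion K := -(β₂ : v.adicCompletion K) ^ 3 + 3 * (4 * β₂ * β₄) -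
    3 ^ 2 * (8 * β₆) with hI
  have hc₆ : N.c₆ = 3 ^ m * I := by
    rw [WeierstrassCurve.c₆, hb₂, hb₄, hb₆, hI]
    rcases hk with ⟨rfl, rfl, rfl, rfl⟩ | ⟨rfl, rfl, rfl, rfl⟩ <;> ring
  have hIle : w I ≤ exp (-2 : ℤ) := by
    rw [hI]
    refine Valuation.map_sub_le w (Valuation.map_add_le w ?_ ?_) ?_
    · rw [Valuation.map_neg, map_pow]
      calc w (β₂ : v.adicCompletion K) ^ 3 ≤ exp (-1 : ℤ) ^ 3 := pow_le_pow_left' hβ₂ 3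
        _ ≤ exp (-2 : ℤ) := by rw [← exp_nsmul, exp_le_exp]; norm_num
    · rw [map_mul, w3, map_mul, map_mul]
      calc exp (-1 : ℤ) * (w 4 * w (β₂ : v.adicCompletion K) * w (β₄ : v.adicCompletion K))
          ≤ exp (-1 : ℤ) * (1 * exp (-1 : ℤ) * 1) :=
            mul_le_mul' le_rfl (mul_le_mul' (mul_le_mul' (by exact_mod_cast hnat 4) hβ₂) (hint β₄))
        _ = exp (-2 : ℤ) := by rw [one_mul, mul_one, ← exp_add]; norm_num
    · rw [map_mul, map_pow, w3, map_mul, ← exp_nsmul]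
      calc exp (2 • (-1 : ℤ)) * (w 8 * w (β₆ : v.adicCompletion K)) ≤ exp (2 • (-1 : ℤ)) * (1 * 1) :=
            mul_le_mul' le_rfl (mul_le_mul' (by exact_mod_cast hnat 8) (hint β₆))
        _ = exp (-2 : ℤ) := by simp
  rw [hc₆, map_mul, map_pow, w3, ← exp_nsmul]
  calc exp (m • (-1 : ℤ)) * w I ≤ exp (m • (-1 : ℤ)) * exp (-2 : ℤ) := mul_le_mul' le_rfl hIle
    _ = exp (-((m : ℤ) + 2)) := by rw [← exp_add]; congr 1; simp only [nsmul_eq_mul]; ring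

end Local

end Summit.BirchSwinnertonDyer.Rank1Residual.Additive

end
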